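import Summits.Ventures.PercRepro.Night2ShapeOneMainB

/-!
# PercRepro — THE SEVEN-POINT SHAPE (i): THE COLUMN BOUND OF THE GOOD-TARGET RULE (night-2, gen 30)

`dload_gt_le_cap2_of_shape_one`: at a target `S` (cell `(2, 1)`, at most one fat closure) with `coloops (S ∖ K) = {w}`,
`|S ∖ K| = 7`, `rk (S ∖ K) = 5` and two DISJOINT collinear triples `R₁`, `R₂` in `S ∖ K` — the only open
configuration of `dload_gt_le_cap2_of_card_coloops_le_one''` (gen 29) — the rule `dshGT` satisfies
`dload S ≤ cap2 S`: the good-target loads of the six points of the lines (Night2ShapeOneSidePack, one line at a time)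
are bounded by the finite check `shapeOne_finite_check` (Night2ShapeOneCheck) with the coupling counts of
Night2ShapeOneCounts fed by the cross-side facts of Night2ShapeOneCross; the capacity is `≥ 11/18 − r_H` when
`|G ∖ S| ≥ 4` and `1` otherwise (`cap2_eq_one_of_card_le`).  Hence **`dload_gt_le_cap2_of_card_coloops_le_one'''`**:
THE COLUMN BOUND OF `dshGT` AT EVERY TARGET WITH AT MOST ONE COLOOP OFF `K` (proofs/NIGHT-2-g30.md §5).
-/

namespace PercRepro.Shadow

open Finset PerFlat ThmH

variable {α : Type*} [DecidableEq α] {M : Matroid α} [M.Finite] {G : Finset α}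

section MainC

set_option maxHeartbeats 12000000 in
open scoped Classical in
/-- **THE SHAPE-(i) COLUMN BOUND.** -/
theorem dload_gt_le_cap2_of_shape_one (hG : G ∈ flatsQ M (5 + 1)) (hd : (gr M \ G).card = 2)
    (hk : kColoops M G = 1) (hs : ∀ e ∈ gr M, ∀ f ∈ gr M, e ≠ f → rkN M {e, f} = 2)
    (hl : ∀ e ∈ gr M, M.Indep {e}) (hfat : (fatClosures M 5 G 2).card ≤ 1) {S : Finset α} (hSG : S ⊆ G)
    (hKS : coloops M G ⊆ S) {w : α} (hc : coloops M (S \ coloops M G) = {w}) (h7 : (S \ coloops M G).card = 7)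
    (hV5 : rkN M (S \ coloops M G) = 5) {R₁ R₂ : Finset α} (hR₁ : R₁ ⊆ S \ coloops M G)
    (hR₂ : R₂ ⊆ S \ coloops M G) (h₁ : R₁.card = 3) (h₂ : R₂.card = 3) (hr₁ : rkN M R₁ = 2) (hr₂ : rkN M R₂ = 2)
    (hdis : Disjoint R₁ R₂) :
    dload M 5 G (bigP M G) (dshGT M 5 G) S ≤ cap2 M 5 G S := by
  have hd' : (gr M \ G).card ≤ 5 := by omega
  have hGg : G ⊆ gr M := (mem_flatsQ.1 hG).1
  have hSg : S ⊆ gr M := hSG.trans hGg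
  have hVg : S \ coloops M G ⊆ gr M := Finset.sdiff_subset.trans hSg
  have hwc : w ∈ coloops M (S \ coloops M G) := by rw [hc]; exact Finset.mem_singleton_self _
  have hwV : w ∈ S \ coloops M G := (mem_coloops.1 hwc).1
  have hwS : w ∈ S := (Finset.mem_sdiff.1 hwV).1
  have hw₁ : w ∉ R₁ := notMem_line_of_mem_coloops hs hVg hwc hR₁ h₁ hr₁
  have hw₂ : w ∉ R₂ := notMem_line_of_mem_coloops hs hVg hwc hR₂ h₂ hr₂
  have hV := shapeOne_eq_insert h7 hwV hR₁ hR₂ h₁ h₂ hdis hw₁ hw₂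
  obtain ⟨a₁, a₂, a₃, ha12, ha13, ha23, hR₁e⟩ := Finset.card_eq_three.1 h₁
  obtain ⟨b₁, b₂, b₃, hb12, hb13, hb23, hR₂e⟩ := Finset.card_eq_three.1 h₂
  have ha₁R : a₁ ∈ R₁ := by rw [hR₁e]; simp
  have ha₂R : a₂ ∈ R₁ := by rw [hR₁e]; simp
  have ha₃R : a₃ ∈ R₁ := by rw [hR₁e]; simp
  have hb₁R : b₁ ∈ R₂ := by rw [hR₂e]; simp
  have hb₂R : b₂ ∈ R₂ := by rw [hR₂e]; simp
  have hb₃R : b₃ ∈ R₂ := by rw [hR₂e]; simp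
  have ha₁V := hR₁ ha₁R
  have ha₂V := hR₁ ha₂R
  have ha₃V := hR₁ ha₃R
  have hb₁V := hR₂ hb₁R
  have hb₂V := hR₂ hb₂R
  have hb₃V := hR₂ hb₃R
  have ha₁S : a₁ ∈ S := (Finset.mem_sdiff.1 ha₁V).1
  have ha₂S : a₂ ∈ S := (Finset.mem_sdiff.1 ha₂V).1
  have ha₃S : a₃ ∈ S := (Finset.mem_sdiff.1 ha₃V).1
  have hb₁S : b₁ ∈ S := (Finset.mem_sdiff.1 hb₁V).1
  have hb₂S : b₂ ∈ S := (Finset.mem_sdiff.1 hb₂V).1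
  have hb₃S : b₃ ∈ S := (Finset.mem_sdiff.1 hb₃V).1
  have hca₁ := notMem_coloops_of_mem_line hs hVg hc hR₁ h₁ hr₁ ha₁R
  have hca₂ := notMem_coloops_of_mem_line hs hVg hc hR₁ h₁ hr₁ ha₂R
  have hca₃ := notMem_coloops_of_mem_line hs hVg hc hR₁ h₁ hr₁ ha₃R
  have hcb₁ := notMem_coloops_of_mem_line hs hVg hc hR₂ h₂ hr₂ hb₁R
  have hcb₂ := notMem_coloops_of_mem_line hs hVg hc hR₂ h₂ hr₂ hb₂R
  have hcb₃ := notMem_coloops_of_mem_line hs hVg hc hR₂ h₂ hr₂ hb₃R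
  have hcolA₂ := mem_coloops_erase_of_line hs hVg hV5 h7 hc hR₁ hR₂ h₁ h₂ hr₁ hr₂ hdis ha₁R ha₂R ha12
  have hcolA₃ := mem_coloops_erase_of_line hs hVg hV5 h7 hc hR₁ hR₂ h₁ h₂ hr₁ hr₂ hdis ha₁R ha₃R ha13
  have hcolB₂ := mem_coloops_erase_of_line hs hVg hV5 h7 hc hR₂ hR₁ h₂ h₁ hr₂ hr₁ hdis.symm hb₁R hb₂R hb12
  have hcolB₃ := mem_coloops_erase_of_line hs hVg hV5 h7 hc hR₂ hR₁ h₂ h₁ hr₂ hr₁ hdis.symm hb₁R hb₃R hb13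
  have hR₁S' : R₁ ⊆ S := fun a ha => (Finset.mem_sdiff.1 (hR₁ ha)).1
  have hwa₁ : w ≠ a₁ := fun h => hw₁ (h ▸ ha₁R)
  have hwa₂ : w ≠ a₂ := fun h => hw₁ (h ▸ ha₂R)
  have hwa₃ : w ≠ a₃ := fun h => hw₁ (h ▸ ha₃R)
  have hwb₁ : w ≠ b₁ := fun h => hw₂ (h ▸ hb₁R)
  have hwb₂ : w ≠ b₂ := fun h => hw₂ (h ▸ hb₂R)
  have hwb₃ : w ≠ b₃ := fun h => hw₂ (h ▸ hb₃R)
  -- THE SUM OVER THE SIX POINTS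
  have hsum := dload_gt_le_sum (P := bigP M G) hG hd' S
  rw [sum_gtLoadAt_eq_lines hG hd hk hs hl hSG hc hV hw₁ hw₂, Finset.sum_union hdis, hR₁e, hR₂e] at hsum
  rw [Finset.sum_insert (by simp [ha12, ha13]), Finset.sum_insert (by simp [ha23]), Finset.sum_singleton,
    Finset.sum_insert (by simp [hb12, hb13]), Finset.sum_insert (by simp [hb23]), Finset.sum_singleton] at hsum
  -- THE REQUEST `r_H`
  obtain ⟨rH, hreqw, hL1rH, hHfat, hHnn, hH2, hH3, hrH'⟩ := rH_of_shape hG hd hSG hc hV5 hV hw₁ hw₂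
  have hreqwA : ∀ y ∈ S \ coloops M G, y ≠ w → y ∉ coloops M (S \ coloops M G) → (y = a₁ ∨ y = a₂ ∨ y = a₃) →
      (S.erase y).erase w ∈ thinMembers M 5 G → req M 5 ((S.erase y).erase w) = rH := by
    intro y hyV hyw hyc hy3 hthin
    refine hreqw y hyV hyw hyc ?_ hthin
    rw [Finset.mem_union, hR₁e]
    rcases hy3 with rfl | rfl | rfl <;> simp
  have hreqwB : ∀ y ∈ S \ coloops M G, y ≠ w → y ∉ coloops M (S \ coloops M G) → (y = b₁ ∨ y = b₂ ∨ y = b₃) →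
      (S.erase y).erase w ∈ thinMembers M 5 G → req M 5 ((S.erase y).erase w) = rH := by
    intro y hyV hyw hyc hy3 hthin
    refine hreqw y hyV hyw hyc ?_ hthin
    rw [Finset.mem_union, hR₂e]
    rcases hy3 with rfl | rfl | rfl <;> simp
  -- THE SOURCE CASE SPLIT: with no source on the lines every load vanishes
  by_cases hsrc : ∃ y ∈ R₁ ∪ R₂, ∃ w' ∈ S.erase y, faceLossP M 5 G (bigP M G) (S.erase y) w' ≠ 0
  swap
  · push Not at hsrc
    have hz : ∀ y ∈ R₁ ∪ R₂, gtLoadAt M 5 G (bigP M G) (S.erase y) y = 0 := fun y hy =>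
      gtLoadAt_eq_zero_of_faceLossP_eq_zero _ (fun w' hw' => hsrc y hy w' hw') y
    have hcapS := capS_ge_eleven_eighteenths_two_one hd hk hSG
    have hcap2 := cap2_ge_capS_sub_L1_of_le hG hd' S
    rw [hz a₁ (by rw [Finset.mem_union, hR₁e]; simp), hz a₂ (by rw [Finset.mem_union, hR₁e]; simp),
      hz a₃ (by rw [Finset.mem_union, hR₁e]; simp), hz b₁ (by rw [Finset.mem_union, hR₂e]; simp),
      hz b₂ (by rw [Finset.mem_union, hR₂e]; simp), hz b₃ (by rw [Finset.mem_union, hR₂e]; simp)] at hsum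
    linarith
  -- a source: `m_H ≥ 2`
  have hmH2 : 2 ≤ (G \ clF M (S.erase w)).card := by
    obtain ⟨y, hyR, w', hw', h0⟩ := hsrc
    rw [Finset.mem_union, hR₁e, hR₂e] at hyR
    simp only [Finset.mem_insert, Finset.mem_singleton] at hyR
    rcases hyR with (rfl | rfl | rfl) | (rfl | rfl | rfl)
    · exact two_le_mH_of_source hG hd hk hs hl hSG hV5 hc ha₁V hca₁ hcolA₂ hcolA₃ hwa₂ hwa₃ ha23 hw' h0
    · exact two_le_mH_of_source hG hd hk hs hl hSG hV5 hc ha₂V hca₂ (mem_coloops_erase_of_line hs hVg hV5 h7 hc hR₁ hR₂ h₁ h₂ hr₁ hr₂ hdis ha₂R ha₁R ha12.symm) (mem_coloops_erase_of_line hs hVg hV5 h7 hc hR₁ hR₂ h₁ h₂ hr₁ hr₂ hdis ha₂R ha₃R ha23) hwa₁ hwa₃ ha13 hw' h0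
    · exact two_le_mH_of_source hG hd hk hs hl hSG hV5 hc ha₃V hca₃ (mem_coloops_erase_of_line hs hVg hV5 h7 hc hR₁ hR₂ h₁ h₂ hr₁ hr₂ hdis ha₃R ha₁R ha13.symm) (mem_coloops_erase_of_line hs hVg hV5 h7 hc hR₁ hR₂ h₁ h₂ hr₁ hr₂ hdis ha₃R ha₂R ha23.symm) hwa₁ hwa₂ ha12 hw' h0
    · exact two_le_mH_of_source hG hd hk hs hl hSG hV5 hc hb₁V hcb₁ hcolB₂ hcolB₃ hwb₂ hwb₃ hb23 hw' h0
    · exact two_le_mH_of_source hG hd hk hs hl hSG hV5 hc hb₂V hcb₂ (mem_coloops_erase_of_line hs hVg hV5 h7 hc hR₂ hR₁ h₂ h₁ hr₂ hr₁ hdis.symm hb₂R hb₁R hb12.symm) (mem_coloops_erase_of_line hs hVg hV5 h7 hc hR₂ hR₁ h₂ h₁ hr₂ hr₁ hdis.symm hb₂R hb₃R hb23) hwb₁ hwb₃ hb13 hw' h0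
    · exact two_le_mH_of_source hG hd hk hs hl hSG hV5 hc hb₃V hcb₃ (mem_coloops_erase_of_line hs hVg hV5 h7 hc hR₂ hR₁ h₂ h₁ hr₂ hr₁ hdis.symm hb₃R hb₁R hb13.symm) (mem_coloops_erase_of_line hs hVg hV5 h7 hc hR₂ hR₁ h₂ h₁ hr₂ hr₁ hdis.symm hb₃R hb₂R hb23.symm) hwb₁ hwb₂ hb12 hw' h0
  -- THE TWO PACKAGES
  obtain ⟨hP1, hmHA, hmA₁, hmA₂, hmA₃, hbA₁, hbA₂, hbA₃⟩ := shapeOne_side_package hG hd hk hs hl hSG hKS hc hV5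
    ha₁V ha₂V ha₃V ha12 ha13 ha23 hca₁ hca₂ hca₃ hcolA₂ hcolA₃ hreqwA
  obtain ⟨hQ1, hmHB, hmB₁, hmB₂, hmB₃, hbB₁, hbB₂, hbB₃⟩ := shapeOne_side_package hG hd hk hs hl hSG hKS hc hV5
    hb₁V hb₂V hb₃V hb12 hb13 hb23 hcb₁ hcb₂ hcb₃ hcolB₂ hcolB₃ hreqwB
  -- THE BASES
  obtain ⟨PA, hPA⟩ : ∃ P : Finset α, P = ((S.erase a₁).erase a₂).erase a₃ := ⟨_, rfl⟩
  obtain ⟨PB, hPB⟩ : ∃ P : Finset α, P = ((S.erase b₁).erase b₂).erase b₃ := ⟨_, rfl⟩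
  simp only [← hPA] at hP1 hmA₁ hmA₂ hmA₃ hbA₁ hbA₂ hbA₃ hmHA
  simp only [← hPB] at hQ1 hmB₁ hmB₂ hmB₃ hbB₁ hbB₂ hbB₃ hmHB
  have hPA' : PA = S \ R₁ := by rw [hPA, erase_three_eq_sdiff, hR₁e]
  have hPB' : PB = S \ R₂ := by rw [hPB, erase_three_eq_sdiff, hR₂e]
  have hPAg : PA ⊆ gr M := by rw [hPA']; exact Finset.sdiff_subset.trans hSg
  have hPBg : PB ⊆ gr M := by rw [hPB']; exact Finset.sdiff_subset.trans hSg
  have hPA4 : rkN M PA = 4 := by rw [hPA']; exact rkN_base_eq_four hG hk hSG hKS hc hR₁ hR₂ hr₂ hV hw₁ hw₂ hdis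
  have hPB4 : rkN M PB = 4 := by
    rw [hPB']; exact rkN_base_eq_four hG hk hSG hKS hc hR₂ hR₁ hr₁ (by rw [hV, Finset.union_comm]) hw₂ hw₁ hdis.symm
  have hwPA : w ∈ PA := by rw [hPA']; exact Finset.mem_sdiff.2 ⟨hwS, hw₁⟩
  have hwPB : w ∈ PB := by rw [hPB']; exact Finset.mem_sdiff.2 ⟨hwS, hw₂⟩
  have hbPA : ∀ b ∈ R₂, b ∈ PA := fun b hb => by
    rw [hPA']; exact Finset.mem_sdiff.2 ⟨(Finset.mem_sdiff.1 (hR₂ hb)).1, Finset.disjoint_right.1 hdis hb⟩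
  have haPB : ∀ a ∈ R₁, a ∈ PB := fun a ha => by
    rw [hPB']; exact Finset.mem_sdiff.2 ⟨(Finset.mem_sdiff.1 (hR₁ ha)).1, Finset.disjoint_left.1 hdis ha⟩
  -- the faces as insertions (both sides)
  have hFA₁₂ : (S.erase a₁).erase a₂ = insert a₃ PA := by rw [hPA]; exact face_eq_insert_base ha₃S ha13 ha23
  have hFA₁₃ : (S.erase a₁).erase a₃ = insert a₂ PA := by rw [hPA]; exact face_eq_insert_base' ha₂S ha12 ha23
  have hFA₂₃ : (S.erase a₂).erase a₃ = insert a₁ PA := by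
    rw [hPA]; ext x; simp only [Finset.mem_erase, Finset.mem_insert]
    constructor
    · rintro ⟨h3, h2, hS⟩
      by_cases h1 : x = a₁
      · exact Or.inl h1
      · exact Or.inr ⟨h3, h2, h1, hS⟩
    · rintro (rfl | ⟨h3, h2, -, hS⟩)
      · exact ⟨ha13, ha12, ha₁S⟩
      · exact ⟨h3, h2, hS⟩
  have hFA₂₁ : (S.erase a₂).erase a₁ = insert a₃ PA := by rw [Finset.erase_right_comm]; exact hFA₁₂
  have hFA₃₁ : (S.erase a₃).erase a₁ = insert a₂ PA := by rw [Finset.erase_right_comm]; exact hFA₁₃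
  have hFA₃₂ : (S.erase a₃).erase a₂ = insert a₁ PA := by rw [Finset.erase_right_comm]; exact hFA₂₃
  have hFB₁₂ : (S.erase b₁).erase b₂ = insert b₃ PB := by rw [hPB]; exact face_eq_insert_base hb₃S hb13 hb23
  have hFB₁₃ : (S.erase b₁).erase b₃ = insert b₂ PB := by rw [hPB]; exact face_eq_insert_base' hb₂S hb12 hb23
  have hFB₂₃ : (S.erase b₂).erase b₃ = insert b₁ PB := by
    rw [hPB]; ext x; simp only [Finset.mem_erase, Finset.mem_insert]
    constructor
    · rintro ⟨h3, h2, hS⟩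
      by_cases h1 : x = b₁
      · exact Or.inl h1
      · exact Or.inr ⟨h3, h2, h1, hS⟩
    · rintro (rfl | ⟨h3, h2, -, hS⟩)
      · exact ⟨hb13, hb12, hb₁S⟩
      · exact ⟨h3, h2, hS⟩
  have hFB₂₁ : (S.erase b₂).erase b₁ = insert b₃ PB := by rw [Finset.erase_right_comm]; exact hFB₁₂
  have hFB₃₁ : (S.erase b₃).erase b₁ = insert b₂ PB := by rw [Finset.erase_right_comm]; exact hFB₁₃
  have hFB₃₂ : (S.erase b₃).erase b₂ = insert b₁ PB := by rw [Finset.erase_right_comm]; exact hFB₂₃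
  -- DISTINCTNESS OF THE SEVEN CLOSURES
  have hwH : w ∉ clF M (S.erase w) := coloop_notMem_clF_erase hG hk hSG hKS hwc
  have hmemA : ∀ p x, x ∈ insert p PA → p ∈ gr M → x ∈ clF M (insert p PA) := fun p x hx hp =>
    subset_clF_of_subset_gr (Finset.insert_subset hp hPAg) hx
  have hmemB : ∀ q x, x ∈ insert q PB → q ∈ gr M → x ∈ clF M (insert q PB) := fun q x hx hq =>
    subset_clF_of_subset_gr (Finset.insert_subset hq hPBg) hx
  have dHA₁ : clF M (S.erase w) ≠ clF M (insert a₁ PA) := fun h => hwH (h ▸ hmemA a₁ w (Finset.mem_insert_of_mem hwPA) (hSg ha₁S))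
  have dHA₂ : clF M (S.erase w) ≠ clF M (insert a₂ PA) := fun h => hwH (h ▸ hmemA a₂ w (Finset.mem_insert_of_mem hwPA) (hSg ha₂S))
  have dHA₃ : clF M (S.erase w) ≠ clF M (insert a₃ PA) := fun h => hwH (h ▸ hmemA a₃ w (Finset.mem_insert_of_mem hwPA) (hSg ha₃S))
  have dHB₁ : clF M (S.erase w) ≠ clF M (insert b₁ PB) := fun h => hwH (h ▸ hmemB b₁ w (Finset.mem_insert_of_mem hwPB) (hSg hb₁S))
  have dHB₂ : clF M (S.erase w) ≠ clF M (insert b₂ PB) := fun h => hwH (h ▸ hmemB b₂ w (Finset.mem_insert_of_mem hwPB) (hSg hb₂S))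
  have dHB₃ : clF M (S.erase w) ≠ clF M (insert b₃ PB) := fun h => hwH (h ▸ hmemB b₃ w (Finset.mem_insert_of_mem hwPB) (hSg hb₃S))
  -- within a side: `y ∉ cl ((S ∖ y) ∖ y′)`
  have nA₁₂ := notMem_clF_face_pair hG hk hSG hKS hV5 ha₁V ha₂V hca₁ hca₂ hcolA₂
  have nA₁₃ := notMem_clF_face_pair hG hk hSG hKS hV5 ha₁V ha₃V hca₁ hca₃ hcolA₃
  have nA₂₃ := notMem_clF_face_pair hG hk hSG hKS hV5 ha₂V ha₃V hca₂ hca₃ (mem_coloops_erase_of_line hs hVg hV5 h7 hc hR₁ hR₂ h₁ h₂ hr₁ hr₂ hdis ha₂R ha₃R ha23)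
  have nA₂₁ := notMem_clF_face_pair hG hk hSG hKS hV5 ha₂V ha₁V hca₂ hca₁ (mem_coloops_erase_of_line hs hVg hV5 h7 hc hR₁ hR₂ h₁ h₂ hr₁ hr₂ hdis ha₂R ha₁R ha12.symm)
  have nB₁₂ := notMem_clF_face_pair hG hk hSG hKS hV5 hb₁V hb₂V hcb₁ hcb₂ hcolB₂
  have nB₁₃ := notMem_clF_face_pair hG hk hSG hKS hV5 hb₁V hb₃V hcb₁ hcb₃ hcolB₃
  have nB₂₃ := notMem_clF_face_pair hG hk hSG hKS hV5 hb₂V hb₃V hcb₂ hcb₃ (mem_coloops_erase_of_line hs hVg hV5 h7 hc hR₂ hR₁ h₂ h₁ hr₂ hr₁ hdis.symm hb₂R hb₃R hb23)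
  have nB₂₁ := notMem_clF_face_pair hG hk hSG hKS hV5 hb₂V hb₁V hcb₂ hcb₁ (mem_coloops_erase_of_line hs hVg hV5 h7 hc hR₂ hR₁ h₂ h₁ hr₂ hr₁ hdis.symm hb₂R hb₁R hb12.symm)
  rw [hFA₁₂] at nA₁₂; rw [hFA₁₃] at nA₁₃; rw [hFA₂₃] at nA₂₃; rw [hFA₂₁] at nA₂₁
  rw [hFB₁₂] at nB₁₂; rw [hFB₁₃] at nB₁₃; rw [hFB₂₃] at nB₂₃; rw [hFB₂₁] at nB₂₁
  have dA₁₂ : clF M (insert a₁ PA) ≠ clF M (insert a₂ PA) := fun h => nA₁₃ (h ▸ hmemA a₁ a₁ (Finset.mem_insert_self _ _) (hSg ha₁S))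
  have dA₁₃ : clF M (insert a₁ PA) ≠ clF M (insert a₃ PA) := fun h => nA₁₂ (h ▸ hmemA a₁ a₁ (Finset.mem_insert_self _ _) (hSg ha₁S))
  have dA₂₃ : clF M (insert a₂ PA) ≠ clF M (insert a₃ PA) := fun h => nA₂₁ (h ▸ hmemA a₂ a₂ (Finset.mem_insert_self _ _) (hSg ha₂S))
  have dB₁₂ : clF M (insert b₁ PB) ≠ clF M (insert b₂ PB) := fun h => nB₁₃ (h ▸ hmemB b₁ b₁ (Finset.mem_insert_self _ _) (hSg hb₁S))
  have dB₁₃ : clF M (insert b₁ PB) ≠ clF M (insert b₃ PB) := fun h => nB₁₂ (h ▸ hmemB b₁ b₁ (Finset.mem_insert_self _ _) (hSg hb₁S))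
  have dB₂₃ : clF M (insert b₂ PB) ≠ clF M (insert b₃ PB) := fun h => nB₂₁ (h ▸ hmemB b₂ b₂ (Finset.mem_insert_self _ _) (hSg hb₂S))
  -- across the sides: a point of the other line
  have dAB : ∀ p ∈ R₁, ∀ q ∈ R₂, clF M (insert p PA) ≠ clF M (insert q PB) := by
    intro p hp q hq h
    -- pick `b ∈ R₂ ∖ q` with `b ∉ cl (insert q PB)`, while `b ∈ PA`
    rw [hR₂e] at hq
    simp only [Finset.mem_insert, Finset.mem_singleton] at hq
    rcases hq with rfl | rfl | rfl
    · exact nB₂₃ (h ▸ hmemA p b₂ (Finset.mem_insert_of_mem (hbPA b₂ hb₂R)) (hSg (hR₁S' hp)))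
    · exact nB₁₃ (h ▸ hmemA p b₁ (Finset.mem_insert_of_mem (hbPA b₁ hb₁R)) (hSg (hR₁S' hp)))
    · exact nB₁₂ (h ▸ hmemA p b₁ (Finset.mem_insert_of_mem (hbPA b₁ hb₁R)) (hSg (hR₁S' hp)))
  -- THE CROSS FACTS
  -- two faces of a side meet in the base
  have htwoB : ∀ x ∈ G \ S, x ∈ clF M (insert b₁ PB) → x ∈ clF M (insert b₂ PB) → x ∈ clF M (S \ R₂) := by
    intro x hx h1 h2
    rw [← hPB']
    exact mem_clF_sdiff_of_two_faces hG hk hs hSG hKS hV5 hR₂ h₂ hr₂ hR₂e hPB' hPB4 (Finset.mem_sdiff.1 hx).1 h1 h2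
  have htwoA : ∀ x ∈ G \ S, x ∈ clF M (insert a₁ PA) → x ∈ clF M (insert a₂ PA) → x ∈ clF M (S \ R₁) := by
    intro x hx h1 h2
    rw [← hPA']
    exact mem_clF_sdiff_of_two_faces hG hk hs hSG hKS hV5 hR₁ h₁ hr₁ hR₁e hPA' hPA4 (Finset.mem_sdiff.1 hx).1 h1 h2
  have hV' : S \ coloops M G = insert w (R₂ ∪ R₁) := by rw [hV, Finset.union_comm]
  have hG1 : ∀ x ∈ G \ S, x ∈ clF M (S.erase w) → x ∈ clF M (insert b₁ PB) → x ∈ clF M (insert b₂ PB) →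
      x ∈ clF M (insert b₃ PB) → ¬ x ∈ clF M (insert a₁ PA) ∧ ¬ x ∈ clF M (insert a₂ PA) ∧ ¬ x ∈ clF M (insert a₃ PA) := by
    intro x hx hxH h1 h2 _
    have hxB := htwoB x hx h1 h2
    rw [hPA']
    exact ⟨fun h => not_mem_face_of_mem_H_base hG hk hs hSG hKS hV5 hc hR₁ hR₂ hr₁ hr₂ hdis hV hw₁ hw₂ hx hxH hxB ha₁R h,
      fun h => not_mem_face_of_mem_H_base hG hk hs hSG hKS hV5 hc hR₁ hR₂ hr₁ hr₂ hdis hV hw₁ hw₂ hx hxH hxB ha₂R h,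
      fun h => not_mem_face_of_mem_H_base hG hk hs hSG hKS hV5 hc hR₁ hR₂ hr₁ hr₂ hdis hV hw₁ hw₂ hx hxH hxB ha₃R h⟩
  have hG1' : ∀ x ∈ G \ S, x ∈ clF M (S.erase w) → x ∈ clF M (insert a₁ PA) → x ∈ clF M (insert a₂ PA) →
      x ∈ clF M (insert a₃ PA) → ¬ x ∈ clF M (insert b₁ PB) ∧ ¬ x ∈ clF M (insert b₂ PB) ∧ ¬ x ∈ clF M (insert b₃ PB) := by
    intro x hx hxH h1 h2 _
    have hxA := htwoA x hx h1 h2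
    rw [hPB']
    exact ⟨fun h => not_mem_face_of_mem_H_base hG hk hs hSG hKS hV5 hc hR₂ hR₁ hr₂ hr₁ hdis.symm hV' hw₂ hw₁ hx hxH hxA hb₁R h,
      fun h => not_mem_face_of_mem_H_base hG hk hs hSG hKS hV5 hc hR₂ hR₁ hr₂ hr₁ hdis.symm hV' hw₂ hw₁ hx hxH hxA hb₂R h,
      fun h => not_mem_face_of_mem_H_base hG hk hs hSG hKS hV5 hc hR₂ hR₁ hr₂ hr₁ hdis.symm hV' hw₂ hw₁ hx hxH hxA hb₃R h⟩
  have hG3 : ∀ x ∈ G \ S, x ∈ clF M (insert a₁ PA) → x ∈ clF M (insert a₂ PA) → x ∈ clF M (insert a₃ PA) →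
      x ∈ clF M (insert b₁ PB) → x ∈ clF M (insert b₂ PB) → x ∈ clF M (insert b₃ PB) → False := by
    intro x hx h1 h2 _ h4 h5 _
    exact not_mem_both_bases hG hk hs hSG hKS hV5 hc hR₁ hR₂ hr₁ hr₂ hdis hV hw₁ hw₂ hx (htwoA x hx h1 h2) (htwoB x hx h4 h5)
  have hG3' : ∀ x ∈ G \ S, x ∈ clF M (insert b₁ PB) → x ∈ clF M (insert b₂ PB) → x ∈ clF M (insert b₃ PB) →
      x ∈ clF M (insert a₁ PA) → x ∈ clF M (insert a₂ PA) → x ∈ clF M (insert a₃ PA) → False :=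
    fun x hx h4 h5 h6 h1 h2 h3 => hG3 x hx h1 h2 h3 h4 h5 h6
  -- THE COUNTS
  have hC1A := card_free_eq_other_add (X := G \ S) (H := (fun x => x ∈ clF M (S.erase w))) (A₁ := (fun x => x ∈ clF M (insert a₁ PA))) (A₂ := (fun x => x ∈ clF M (insert a₂ PA))) (A₃ := (fun x => x ∈ clF M (insert a₃ PA)))
    (B₁ := (fun x => x ∈ clF M (insert b₁ PB))) (B₂ := (fun x => x ∈ clF M (insert b₂ PB))) (B₃ := (fun x => x ∈ clF M (insert b₃ PB))) hG1
  have hC1B := card_free_eq_other_add (X := G \ S) (H := (fun x => x ∈ clF M (S.erase w))) (A₁ := (fun x => x ∈ clF M (insert b₁ PB))) (A₂ := (fun x => x ∈ clF M (insert b₂ PB))) (A₃ := (fun x => x ∈ clF M (insert b₃ PB)))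
    (B₁ := (fun x => x ∈ clF M (insert a₁ PA))) (B₂ := (fun x => x ∈ clF M (insert a₂ PA))) (B₃ := (fun x => x ∈ clF M (insert a₃ PA))) hG1'
  have hC2A := card_both_eq (X := G \ S) (H := (fun x => x ∈ clF M (S.erase w))) (B₁ := (fun x => x ∈ clF M (insert b₁ PB))) (B₂ := (fun x => x ∈ clF M (insert b₂ PB))) (B₃ := (fun x => x ∈ clF M (insert b₃ PB))) hP1 hG1
  have hC2B := card_both_eq (X := G \ S) (H := (fun x => x ∈ clF M (S.erase w))) (B₁ := (fun x => x ∈ clF M (insert a₁ PA))) (B₂ := (fun x => x ∈ clF M (insert a₂ PA))) (B₃ := (fun x => x ∈ clF M (insert a₃ PA))) hQ1 hG1'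
  have hnHA := card_not_H (X := G \ S) (H := (fun x => x ∈ clF M (S.erase w))) hP1
  have hnHB := card_not_H (X := G \ S) (H := (fun x => x ∈ clF M (S.erase w))) hQ1
  have hC6A := card_zA_le_zeta (X := G \ S) (H := (fun x => x ∈ clF M (S.erase w))) (A₁ := (fun x => x ∈ clF M (insert a₁ PA))) (A₂ := (fun x => x ∈ clF M (insert a₂ PA))) (A₃ := (fun x => x ∈ clF M (insert a₃ PA))) hQ1 hG3
  have hC6B := card_zA_le_zeta (X := G \ S) (H := (fun x => x ∈ clF M (S.erase w))) (A₁ := (fun x => x ∈ clF M (insert b₁ PB))) (A₂ := (fun x => x ∈ clF M (insert b₂ PB))) (A₃ := (fun x => x ∈ clF M (insert b₃ PB))) hP1 hG3'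
  have hC7 := card_eq_sum_classes (X := G \ S) (H := (fun x => x ∈ clF M (S.erase w))) (A₁ := (fun x => x ∈ clF M (insert a₁ PA))) (A₂ := (fun x => x ∈ clF M (insert a₂ PA))) (A₃ := (fun x => x ∈ clF M (insert a₃ PA)))
    (B₁ := (fun x => x ∈ clF M (insert b₁ PB))) (B₂ := (fun x => x ∈ clF M (insert b₂ PB))) (B₃ := (fun x => x ∈ clF M (insert b₃ PB))) hG3
  -- the both-visible set in the two orders
  have hebsym : ((G \ S).filter (fun x => x ∈ clF M (S.erase w) ∧ ¬ (x ∈ clF M (insert b₁ PB) ∧ x ∈ clF M (insert b₂ PB) ∧ x ∈ clF M (insert b₃ PB)) ∧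
        ¬ (x ∈ clF M (insert a₁ PA) ∧ x ∈ clF M (insert a₂ PA) ∧ x ∈ clF M (insert a₃ PA)))).card =
      ((G \ S).filter (fun x => x ∈ clF M (S.erase w) ∧ ¬ (x ∈ clF M (insert a₁ PA) ∧ x ∈ clF M (insert a₂ PA) ∧ x ∈ clF M (insert a₃ PA)) ∧
        ¬ (x ∈ clF M (insert b₁ PB) ∧ x ∈ clF M (insert b₂ PB) ∧ x ∈ clF M (insert b₃ PB)))).card := by
    congr 1
    ext x
    simp only [Finset.mem_filter]
    exact ⟨fun ⟨hx, h1, h2, h3⟩ => ⟨hx, h1, h3, h2⟩, fun ⟨hx, h1, h2, h3⟩ => ⟨hx, h1, h3, h2⟩⟩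
  rw [hebsym] at hC2B
  -- names for the counts
  obtain ⟨fA, hfA⟩ : ∃ n, n = typeCount (G \ S) (fun x => x ∈ clF M (S.erase w)) (fun x => x ∈ clF M (insert a₁ PA)) (fun x => x ∈ clF M (insert a₂ PA)) (fun x => x ∈ clF M (insert a₃ PA)) true false false false := ⟨_, rfl⟩
  obtain ⟨nA₁, hnA₁⟩ : ∃ n, n = typeCount (G \ S) (fun x => x ∈ clF M (S.erase w)) (fun x => x ∈ clF M (insert a₁ PA)) (fun x => x ∈ clF M (insert a₂ PA)) (fun x => x ∈ clF M (insert a₃ PA)) true true false false := ⟨_, rfl⟩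
  obtain ⟨nA₂, hnA₂⟩ : ∃ n, n = typeCount (G \ S) (fun x => x ∈ clF M (S.erase w)) (fun x => x ∈ clF M (insert a₁ PA)) (fun x => x ∈ clF M (insert a₂ PA)) (fun x => x ∈ clF M (insert a₃ PA)) true false true false := ⟨_, rfl⟩
  obtain ⟨nA₃, hnA₃⟩ : ∃ n, n = typeCount (G \ S) (fun x => x ∈ clF M (S.erase w)) (fun x => x ∈ clF M (insert a₁ PA)) (fun x => x ∈ clF M (insert a₂ PA)) (fun x => x ∈ clF M (insert a₃ PA)) true false false true := ⟨_, rfl⟩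
  obtain ⟨zfA, hzfA⟩ : ∃ n, n = typeCount (G \ S) (fun x => x ∈ clF M (S.erase w)) (fun x => x ∈ clF M (insert a₁ PA)) (fun x => x ∈ clF M (insert a₂ PA)) (fun x => x ∈ clF M (insert a₃ PA)) false false false false := ⟨_, rfl⟩
  obtain ⟨zA₁, hzA₁⟩ : ∃ n, n = typeCount (G \ S) (fun x => x ∈ clF M (S.erase w)) (fun x => x ∈ clF M (insert a₁ PA)) (fun x => x ∈ clF M (insert a₂ PA)) (fun x => x ∈ clF M (insert a₃ PA)) false true false false := ⟨_, rfl⟩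
  obtain ⟨zA₂, hzA₂⟩ : ∃ n, n = typeCount (G \ S) (fun x => x ∈ clF M (S.erase w)) (fun x => x ∈ clF M (insert a₁ PA)) (fun x => x ∈ clF M (insert a₂ PA)) (fun x => x ∈ clF M (insert a₃ PA)) false false true false := ⟨_, rfl⟩
  obtain ⟨zA₃, hzA₃⟩ : ∃ n, n = typeCount (G \ S) (fun x => x ∈ clF M (S.erase w)) (fun x => x ∈ clF M (insert a₁ PA)) (fun x => x ∈ clF M (insert a₂ PA)) (fun x => x ∈ clF M (insert a₃ PA)) false false false true := ⟨_, rfl⟩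
  obtain ⟨zAA, hzAA⟩ : ∃ n, n = typeCount (G \ S) (fun x => x ∈ clF M (S.erase w)) (fun x => x ∈ clF M (insert a₁ PA)) (fun x => x ∈ clF M (insert a₂ PA)) (fun x => x ∈ clF M (insert a₃ PA)) false true true true := ⟨_, rfl⟩
  obtain ⟨eA, heA⟩ : ∃ n, n = typeCount (G \ S) (fun x => x ∈ clF M (S.erase w)) (fun x => x ∈ clF M (insert a₁ PA)) (fun x => x ∈ clF M (insert a₂ PA)) (fun x => x ∈ clF M (insert a₃ PA)) true true true true := ⟨_, rfl⟩
  obtain ⟨fB, hfB⟩ : ∃ n, n = typeCount (G \ S) (fun x => x ∈ clF M (S.erase w)) (fun x => x ∈ clF M (insert b₁ PB)) (fun x => x ∈ clF M (insert b₂ PB)) (fun x => x ∈ clF M (insert b₃ PB)) true false false false := ⟨_, rfl⟩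
  obtain ⟨nB₁, hnB₁⟩ : ∃ n, n = typeCount (G \ S) (fun x => x ∈ clF M (S.erase w)) (fun x => x ∈ clF M (insert b₁ PB)) (fun x => x ∈ clF M (insert b₂ PB)) (fun x => x ∈ clF M (insert b₃ PB)) true true false false := ⟨_, rfl⟩
  obtain ⟨nB₂, hnB₂⟩ : ∃ n, n = typeCount (G \ S) (fun x => x ∈ clF M (S.erase w)) (fun x => x ∈ clF M (insert b₁ PB)) (fun x => x ∈ clF M (insert b₂ PB)) (fun x => x ∈ clF M (insert b₃ PB)) true false true false := ⟨_, rfl⟩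
  obtain ⟨nB₃, hnB₃⟩ : ∃ n, n = typeCount (G \ S) (fun x => x ∈ clF M (S.erase w)) (fun x => x ∈ clF M (insert b₁ PB)) (fun x => x ∈ clF M (insert b₂ PB)) (fun x => x ∈ clF M (insert b₃ PB)) true false false true := ⟨_, rfl⟩
  obtain ⟨zfB, hzfB⟩ : ∃ n, n = typeCount (G \ S) (fun x => x ∈ clF M (S.erase w)) (fun x => x ∈ clF M (insert b₁ PB)) (fun x => x ∈ clF M (insert b₂ PB)) (fun x => x ∈ clF M (insert b₃ PB)) false false false false := ⟨_, rfl⟩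
  obtain ⟨zB₁, hzB₁⟩ : ∃ n, n = typeCount (G \ S) (fun x => x ∈ clF M (S.erase w)) (fun x => x ∈ clF M (insert b₁ PB)) (fun x => x ∈ clF M (insert b₂ PB)) (fun x => x ∈ clF M (insert b₃ PB)) false true false false := ⟨_, rfl⟩
  obtain ⟨zB₂, hzB₂⟩ : ∃ n, n = typeCount (G \ S) (fun x => x ∈ clF M (S.erase w)) (fun x => x ∈ clF M (insert b₁ PB)) (fun x => x ∈ clF M (insert b₂ PB)) (fun x => x ∈ clF M (insert b₃ PB)) false false true false := ⟨_, rfl⟩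
  obtain ⟨zB₃, hzB₃⟩ : ∃ n, n = typeCount (G \ S) (fun x => x ∈ clF M (S.erase w)) (fun x => x ∈ clF M (insert b₁ PB)) (fun x => x ∈ clF M (insert b₂ PB)) (fun x => x ∈ clF M (insert b₃ PB)) false false false true := ⟨_, rfl⟩
  obtain ⟨zAB, hzAB⟩ : ∃ n, n = typeCount (G \ S) (fun x => x ∈ clF M (S.erase w)) (fun x => x ∈ clF M (insert b₁ PB)) (fun x => x ∈ clF M (insert b₂ PB)) (fun x => x ∈ clF M (insert b₃ PB)) false true true true := ⟨_, rfl⟩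
  obtain ⟨eB, heB⟩ : ∃ n, n = typeCount (G \ S) (fun x => x ∈ clF M (S.erase w)) (fun x => x ∈ clF M (insert b₁ PB)) (fun x => x ∈ clF M (insert b₂ PB)) (fun x => x ∈ clF M (insert b₃ PB)) true true true true := ⟨_, rfl⟩
  simp only [← hfA, ← hnA₁, ← hnA₂, ← hnA₃, ← hzfA, ← hzA₁, ← hzA₂, ← hzA₃, ← hzAA, ← heA] at hmHA hmA₁ hmA₂ hmA₃ hbA₁ hbA₂ hbA₃ hC1A hC2A hnHA hC6A hC6B hC7 hC1B hC2B
  simp only [← hfB, ← hnB₁, ← hnB₂, ← hnB₃, ← hzfB, ← hzB₁, ← hzB₂, ← hzB₃, ← hzAB, ← heB] at hmHB hmB₁ hmB₂ hmB₃ hbB₁ hbB₂ hbB₃ hC1A hC2A hnHB hC6A hC6B hC7 hC1B hC2B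
  obtain ⟨eb01, heb01⟩ : ∃ n, n = ((G \ S).filter (fun x => x ∈ clF M (S.erase w) ∧ (¬ x ∈ clF M (insert a₁ PA) ∧ ¬ x ∈ clF M (insert a₂ PA) ∧ ¬ x ∈ clF M (insert a₃ PA)) ∧
      ¬ (x ∈ clF M (insert b₁ PB) ∧ x ∈ clF M (insert b₂ PB) ∧ x ∈ clF M (insert b₃ PB)))).card := ⟨_, rfl⟩
  obtain ⟨eb02, heb02⟩ : ∃ n, n = ((G \ S).filter (fun x => x ∈ clF M (S.erase w) ∧ (¬ x ∈ clF M (insert b₁ PB) ∧ ¬ x ∈ clF M (insert b₂ PB) ∧ ¬ x ∈ clF M (insert b₃ PB)) ∧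
      ¬ (x ∈ clF M (insert a₁ PA) ∧ x ∈ clF M (insert a₂ PA) ∧ x ∈ clF M (insert a₃ PA)))).card := ⟨_, rfl⟩
  obtain ⟨eb, heb⟩ : ∃ n, n = ((G \ S).filter (fun x => x ∈ clF M (S.erase w) ∧ ¬ (x ∈ clF M (insert a₁ PA) ∧ x ∈ clF M (insert a₂ PA) ∧ x ∈ clF M (insert a₃ PA)) ∧
      ¬ (x ∈ clF M (insert b₁ PB) ∧ x ∈ clF M (insert b₂ PB) ∧ x ∈ clF M (insert b₃ PB)))).card := ⟨_, rfl⟩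
  obtain ⟨nZ, hnZ⟩ : ∃ n, n = ((G \ S).filter (fun x => ¬ x ∈ clF M (S.erase w))).card := ⟨_, rfl⟩
  rw [← heb01] at hC1A hC2A
  rw [← heb02] at hC1B hC2B
  rw [← heb] at hC2A hC2B hC7
  rw [← hnZ] at hnHA hnHB hC7
  -- THE REQUESTS AND THE FAT RULE
  obtain ⟨ra₁nn, ra₁adm, ra₁0⟩ := faceReq_adm (M := M) (G := G) (F := insert a₁ PA) (s := fA + zfA + (nA₂ + zA₂) + (nA₃ + zA₃)) (by omega)
  obtain ⟨ra₂nn, ra₂adm, ra₂0⟩ := faceReq_adm (M := M) (G := G) (F := insert a₂ PA) (s := fA + zfA + (nA₁ + zA₁) + (nA₃ + zA₃)) (by omega)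
  obtain ⟨ra₃nn, ra₃adm, ra₃0⟩ := faceReq_adm (M := M) (G := G) (F := insert a₃ PA) (s := fA + zfA + (nA₁ + zA₁) + (nA₂ + zA₂)) (by omega)
  obtain ⟨rb₁nn, rb₁adm, rb₁0⟩ := faceReq_adm (M := M) (G := G) (F := insert b₁ PB) (s := fB + zfB + (nB₂ + zB₂) + (nB₃ + zB₃)) (by omega)
  obtain ⟨rb₂nn, rb₂adm, rb₂0⟩ := faceReq_adm (M := M) (G := G) (F := insert b₂ PB) (s := fB + zfB + (nB₁ + zB₁) + (nB₃ + zB₃)) (by omega)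
  obtain ⟨rb₃nn, rb₃adm, rb₃0⟩ := faceReq_adm (M := M) (G := G) (F := insert b₃ PB) (s := fB + zfB + (nB₁ + zB₁) + (nB₂ + zB₂)) (by omega)
  have fa₁ : faceReq M G (insert a₁ PA) = 7 / 24 → clF M (insert a₁ PA) ∈ fatClosures M 5 G 2 := fun h =>
    (clF_mem_fatClosures_of_faceReq_eq (by omega) h).2
  have fa₂ : faceReq M G (insert a₂ PA) = 7 / 24 → clF M (insert a₂ PA) ∈ fatClosures M 5 G 2 := fun h =>
    (clF_mem_fatClosures_of_faceReq_eq (by omega) h).2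
  have fa₃ : faceReq M G (insert a₃ PA) = 7 / 24 → clF M (insert a₃ PA) ∈ fatClosures M 5 G 2 := fun h =>
    (clF_mem_fatClosures_of_faceReq_eq (by omega) h).2
  have fb₁ : faceReq M G (insert b₁ PB) = 7 / 24 → clF M (insert b₁ PB) ∈ fatClosures M 5 G 2 := fun h =>
    (clF_mem_fatClosures_of_faceReq_eq (by omega) h).2
  have fb₂ : faceReq M G (insert b₂ PB) = 7 / 24 → clF M (insert b₂ PB) ∈ fatClosures M 5 G 2 := fun h =>
    (clF_mem_fatClosures_of_faceReq_eq (by omega) h).2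
  have fb₃ : faceReq M G (insert b₃ PB) = 7 / 24 → clF M (insert b₃ PB) ∈ fatClosures M 5 G 2 := fun h =>
    (clF_mem_fatClosures_of_faceReq_eq (by omega) h).2
  have hfatrule := fatRule_of_distinct hfat hHfat fa₁ fa₂ fa₃ fb₁ fb₂ fb₃ dHA₁ dHA₂ dHA₃ dHB₁ dHB₂ dHB₃ dA₁₂ dA₁₃
    (dAB a₁ ha₁R b₁ hb₁R) (dAB a₁ ha₁R b₂ hb₂R) (dAB a₁ ha₁R b₃ hb₃R) dA₂₃ (dAB a₂ ha₂R b₁ hb₁R) (dAB a₂ ha₂R b₂ hb₂R)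
    (dAB a₂ ha₂R b₃ hb₃R) (dAB a₃ ha₃R b₁ hb₁R) (dAB a₃ ha₃R b₂ hb₂R) (dAB a₃ ha₃R b₃ hb₃R) dB₁₂ dB₁₃ dB₂₃
  -- THE FINITE CHECK
  have hcheck := shapeOne_finite_check (e1o := eB) (e2o := eA) (eb := eb) (eb01 := eb01) (eb02 := eb02) (nZ := nZ)
    (mH := (G \ clF M (S.erase w)).card) (rH := rH)
    (fE₁ := fA) (a₁ := nA₁) (a₂ := nA₂) (a₃ := nA₃) (zf₁ := zfA) (z₁ := zA₁) (z₂ := zA₂) (z₃ := zA₃)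
    (s₁ := fA + zfA + (nA₂ + zA₂) + (nA₃ + zA₃)) (s₂ := fA + zfA + (nA₁ + zA₁) + (nA₃ + zA₃))
    (s₃ := fA + zfA + (nA₁ + zA₁) + (nA₂ + zA₂))
    (g₁ := 1 + fA + nA₁ + zfA + (zA₁ + zA₂ + zA₃)) (g₂ := 1 + fA + nA₂ + zfA + (zA₁ + zA₂ + zA₃))
    (g₃ := 1 + fA + nA₃ + zfA + (zA₁ + zA₂ + zA₃))
    (r₁ := faceReq M G (insert a₁ PA)) (r₂ := faceReq M G (insert a₂ PA)) (r₃ := faceReq M G (insert a₃ PA))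
    (fE₂ := fB) (b₁ := nB₁) (b₂ := nB₂) (b₃ := nB₃) (zf₂ := zfB) (y₁ := zB₁) (y₂ := zB₂) (y₃ := zB₃)
    (t₁ := fB + zfB + (nB₂ + zB₂) + (nB₃ + zB₃)) (t₂ := fB + zfB + (nB₁ + zB₁) + (nB₃ + zB₃))
    (t₃ := fB + zfB + (nB₁ + zB₁) + (nB₂ + zB₂))
    (h₁ := 1 + fB + nB₁ + zfB + (zB₁ + zB₂ + zB₃)) (h₂ := 1 + fB + nB₂ + zfB + (zB₁ + zB₂ + zB₃))
    (h₃ := 1 + fB + nB₃ + zfB + (zB₁ + zB₂ + zB₃))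
    (u₁ := faceReq M G (insert b₁ PB)) (u₂ := faceReq M G (insert b₂ PB)) (u₃ := faceReq M G (insert b₃ PB))
    (by omega) (by omega) (by omega) (by omega) (by omega) (by omega) (by omega) (by omega) (by omega)
    rfl rfl rfl rfl rfl rfl rfl rfl rfl rfl rfl rfl hHnn hH2 hH3
    ra₁nn ra₁adm ra₁0 ra₂nn ra₂adm ra₂0 ra₃nn ra₃adm ra₃0 rb₁nn rb₁adm rb₁0 rb₂nn rb₂adm rb₂0 rb₃nn rb₃adm rb₃0 hfatrule
  -- THE CAPACITY
  have hcapS := capS_ge_eleven_eighteenths_two_one hd hk hSG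
  have hcap2 := cap2_ge_capS_sub_L1_of_le hG hd' S
  by_cases hcard : 4 ≤ (G \ S).card
  · have hA := hcheck.1 (by omega)
    linarith
  · have h1 : cap2 M 5 G S = 1 := cap2_eq_one_of_card_le hG (by omega)
    have hB := hcheck.2
    rw [h1]
    linarith

/-- **THE COLUMN BOUND OF THE GOOD-TARGET RULE AT EVERY TARGET WITH AT MOST ONE COLOOP OFF `K`** — the statement of
gen 29 (`dload_gt_le_cap2_of_card_coloops_le_one''`) without its hypothesis `h7`: the seven-point one-coloop targets
with two disjoint collinear triples (shape (i)) are covered by `dload_gt_le_cap2_of_shape_one`. -/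
theorem dload_gt_le_cap2_of_card_coloops_le_one''' (hG : G ∈ flatsQ M (5 + 1)) (hd : (gr M \ G).card = 2)
    (hk : kColoops M G = 1) (hs : ∀ e ∈ gr M, ∀ f ∈ gr M, e ≠ f → rkN M {e, f} = 2)
    (hl : ∀ e ∈ gr M, M.Indep {e}) (hfat : (fatClosures M 5 G 2).card ≤ 1) {S : Finset α} (hSG : S ⊆ G)
    (hKS : coloops M G ⊆ S) (hc1 : (coloops M (S \ coloops M G)).card ≤ 1) :
    dload M 5 G (bigP M G) (dshGT M 5 G) S ≤ cap2 M 5 G S := by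
  by_cases hV5 : rkN M (S \ coloops M G) = 5
  swap
  · exact dload_gt_le_cap2_of_rkN_ne_five hG hd hk hs hl hSG hc1 hV5
  by_cases hshape : (coloops M (S \ coloops M G)).card = 1 ∧ (S \ coloops M G).card = 7 ∧
      ∃ R₁ R₂ : Finset α, R₁ ⊆ S \ coloops M G ∧ R₂ ⊆ S \ coloops M G ∧ R₁.card = 3 ∧ R₂.card = 3 ∧
        rkN M R₁ = 2 ∧ rkN M R₂ = 2 ∧ Disjoint R₁ R₂
  · obtain ⟨h1, h7, R₁, R₂, hR₁, hR₂, h₁, h₂, hr₁, hr₂, hdis⟩ := hshape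
    obtain ⟨w, hw⟩ := Finset.card_eq_one.1 h1
    exact dload_gt_le_cap2_of_shape_one hG hd hk hs hl hfat hSG hKS hw h7 hV5 hR₁ hR₂ h₁ h₂ hr₁ hr₂ hdis
  · apply dload_gt_le_cap2_of_card_coloops_le_one'' hG hd hk hs hl hfat hSG hKS hc1
    intro h1 h7 R₁ R₂ hR₁ hR₂ h₁ h₂ hr₁ hr₂ hdis
    exact hshape ⟨h1, h7, R₁, R₂, hR₁, hR₂, h₁, h₂, hr₁, hr₂, hdis⟩

end MainC

end PercRepro.Shadow
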